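import Mathlib
import HarnessLib
import Summits.HubbardSuperconductivity.HubbardSuperconductivity.Theorems.KLProgrammeC4aPPKernelMidThermal
import Summits.HubbardSuperconductivity.HubbardSuperconductivity.Theorems.KLProgrammeC4aPPKernelMidFlatness
import Summits.HubbardSuperconductivity.HubbardSuperconductivity.Theorems.KLProgrammeC4aPPKernelSplitProfile
import Summits.HubbardSuperconductivity.HubbardSuperconductivity.Theorems.KLProgrammeC4aPPKernelFamilyRows

/-!
# Route `KLProgramme` — crux C4a, S3 brick (B4) «(B4)-UMK1», «(U1)-M-LAW» kernel side: THE ONE-CALL BUNDLE `ppMidKernelS_rows` — the kernel rows of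
# k3c3-p3's 5b-M `abs_intervalIntegral_levelLine_middle_le` for `K e := M(e,·)/C`, plus the band-flatness ENVELOPE and the profile discharge for `ppSplitProfile t₁`

Cell `gate-hubbard-kl`, seat hubbard-kl-k3c3-p1 (g17; row «δμ-flow with klAngularMean constant piece»).  Part 4 of the M-rows (pen (R384)(A)(a)); consumer:
`…C4aPreCausticLevelLineMiddle.abs_intervalIntegral_levelLine_middle_le` (p703948) and its successors in the k3c3-p3 lineage («(U1)-M-LAW» 5c-M, 5d-M, …).
* §1 profile: `deriv_ppSplitProfile_eq_zero_of_le_half`, `deriv_deriv_ppSplitProfile_eq_zero_of_le_half`,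
  **`ppSplitProfile_admissible_mid`** (the three extra rows `κ = 1`, `κ′ = 0`, `κ″ = 0` on `(−∞, t₁/2]` asked by the M-rows, for the profile of record);
* §2 **`abs_intervalIntegral_band_le_of_envelope`** (GENERIC band-flatness ENVELOPE: any kernel with `|∂ᵤK(e,u)| ≤ (max e |u|)⁻²` for `e > 0` and any weight
  `|w| ≤ W` on the band give `|∫_a^b w·∂ᵤK(e,D−e)| ≤ (4W/D²)·|b − a|` for `0 < a`, `0 < b` — on the anti-diagonal `max(e,|D−e|) ≥ D/2`; this is the `A_t` of
  5b-M in the `1/D`-class; the sharper `lo/D²`-class constant-weight flatness of `M` is a separate theorem, not here),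
  **`abs_intervalIntegral_tail_le_of_envelope`** (the TAIL shape `|∫_a^b w·∂ᵤK(e,D−e)| ≤ W/a`, every `D`: the `A_t/max(D,lo)`-class named on the bus);
* §3 **`ppMidKernelS_rows`**: for `C ≥ C₁, C₂` the rows `hK, hK0, hK1, hK2, hcomp (q_c := 2q′), hKopp (C_t := C_t^M/C), hKc` of 5b-M IN ITS SHAPES, `q′ = (2−t₁)/t₁`;
* §4 **`abs_midFlatness_band_const_weight_le`** (the CONSTANT-WEIGHT band/line flatness of `K = M/C` in the `lo/D²` class, from `…MidFlatness`).
Pure real analysis; nothing asserts (C), K3, the window or superconductivity.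
References: BGM 2006 §2.4 (2.36) [cite: BenfattoGiulianiMastropietro2006]; FST II CPAM 51 (1998) §3 [cite: FeldmanSalmhoferTrubowitz1998];
Salmhofer 1999 §4.2.5 [cite: Salmhofer1999].
-/

noncomputable section

namespace Summit.HubbardSuperconductivity.HubbardSuperconductivity.Theorems.C4a

set_option linter.dupNamespace false -- summit = problem name (single-conjunct summit), D-0017

open Real Filter Set MeasureTheory intervalIntegral
open scoped Topology Interval
open Literature.MathematicalPhysics.QuantumLattice Literature.Analysis.SpecialFunctions

/-! ## §1 The profile of record meets the three extra rows -/

/-- `κ_{t₁}′(t) = 0` for `t ≤ t₁/2`. [folklore] -/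
theorem deriv_ppSplitProfile_eq_zero_of_le_half {t₁ t : ℝ} (ht₀ : 0 < t₁) (ht : t ≤ t₁ / 2) : deriv (ppSplitProfile t₁) t = 0 := by
  have hin : 1 ≤ 2 - 2 / t₁ * t := by rw [div_mul_eq_mul_div, le_sub_comm, div_le_iff₀ ht₀]; linarith
  rw [deriv_ppSplitProfile, Literature.Analysis.Calculus.deriv_smoothTransition_of_one_le hin, mul_zero]

/-- `κ_{t₁}″(t) = 0` for `t ≤ t₁/2`. [folklore] -/
theorem deriv_deriv_ppSplitProfile_eq_zero_of_le_half {t₁ t : ℝ} (ht₀ : 0 < t₁) (ht : t ≤ t₁ / 2) : deriv (deriv (ppSplitProfile t₁)) t = 0 := by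
  have hin : 1 ≤ 2 - 2 / t₁ * t := by rw [div_mul_eq_mul_div, le_sub_comm, div_le_iff₀ ht₀]; linarith
  rw [deriv_deriv_ppSplitProfile, Literature.Analysis.FluidPDE.Wei2016.deriv_deriv_smoothTransition_of_one_le hin, mul_zero]

/-- **The profile of record meets the M-rows' extra hypotheses**: `κ = 1`, `κ′ = 0`, `κ″ = 0` on `(−∞, t₁/2]` for `κ := ppSplitProfile t₁` (`0 < t₁`).
[cite: FeldmanSalmhoferTrubowitz1998, §3] -/
theorem ppSplitProfile_admissible_mid {t₁ : ℝ} (ht₀ : 0 < t₁) :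
    (∀ t, t ≤ t₁ / 2 → ppSplitProfile t₁ t = 1) ∧ (∀ t, t ≤ t₁ / 2 → deriv (ppSplitProfile t₁) t = 0) ∧
      (∀ t, t ≤ t₁ / 2 → deriv (deriv (ppSplitProfile t₁)) t = 0) :=
  ⟨fun _ ht => ppSplitProfile_eq_one_of_le ht₀ ht, fun _ ht => deriv_ppSplitProfile_eq_zero_of_le_half ht₀ ht,
    fun _ ht => deriv_deriv_ppSplitProfile_eq_zero_of_le_half ht₀ ht⟩

/-! ## §2 The band-flatness envelope (generic) -/

set_option maxHeartbeats 400000 in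
/-- **Band-flatness ENVELOPE**: `|∂ᵤK(e,u)| ≤ (max e |u|)⁻²` for all `e > 0` and all `u`, `|w| ≤ W` on `Ι a b`, `0 < a`, `0 < b`, `0 < D` ⟹
`|∫_a^b w(e)·∂ᵤK(e, D−e) de| ≤ (4W/D²)·|b − a|` (on the anti-diagonal `max(e, |D−e|) ≥ D/2`). [folklore] -/
theorem abs_intervalIntegral_band_le_of_envelope {K : ℝ → ℝ → ℝ} {w : ℝ → ℝ} {a b D W : ℝ} (ha : 0 < a) (hb : 0 < b) (hD : 0 < D) (hW : 0 ≤ W)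
    (hK1 : ∀ e, 0 < e → ∀ u, |deriv (K e) u| ≤ (max e |u|)⁻¹ ^ 2) (hw : ∀ e ∈ Ι a b, |w e| ≤ W) :
    |∫ e in a..b, w e * deriv (K e) (D - e)| ≤ 4 * W / D ^ 2 * |b - a| := by
  have hbound : ∀ e ∈ Ι a b, ‖w e * deriv (K e) (D - e)‖ ≤ 4 * W / D ^ 2 := by
    intro e he
    have he0 : 0 < e := by
      have := he.1; rcases le_total a b with h | h
      · rw [uIoc_of_le h] at he; exact ha.trans he.1
      · rw [uIoc_of_ge h] at he; exact hb.trans he.1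
    have hM : D / 2 ≤ max e |D - e| := by
      rcases le_or_gt (D / 2) e with h | h
      · exact h.trans (le_max_left _ _)
      · exact le_trans (by rw [abs_of_pos (by linarith)]; linarith) (le_max_right _ _)
    have hMpos : 0 < max e |D - e| := he0.trans_le (le_max_left _ _)
    have hinv : (max e |D - e|)⁻¹ ^ 2 ≤ 4 / D ^ 2 := by
      rw [inv_pow, show 4 / D ^ 2 = ((D / 2) ^ 2)⁻¹ by field_simp; ring]
      exact inv_anti₀ (by positivity) (pow_le_pow_left₀ (by positivity) hM 2)
    rw [Real.norm_eq_abs, abs_mul]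
    calc |w e| * |deriv (K e) (D - e)| ≤ W * (4 / D ^ 2) := mul_le_mul (hw e he) ((hK1 e he0 _).trans hinv) (abs_nonneg _) hW
      _ = 4 * W / D ^ 2 := by ring
  have h := intervalIntegral.norm_integral_le_of_norm_le_const hbound
  rw [Real.norm_eq_abs] at h
  exact h


/-- **Tail-flatness ENVELOPE** (the `A_t/max(D,lo)` shape named on the bus, k3c3-p1 g16 07:03Z): `|∂ᵤK(e,u)| ≤ (max e |u|)⁻²` for `e > 0`, `|w| ≤ W` on `Ι a b`,
`0 < a ≤ b` ⟹ `|∫_a^b w(e)·∂ᵤK(e, D−e) de| ≤ W/a` (pointwise `(max e |D−e|)⁻² ≤ 1/e²`), for EVERY `D`; combine with the band envelope (`4W|b−a|/D²`)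
as needed. [folklore] -/
theorem abs_intervalIntegral_tail_le_of_envelope {K : ℝ → ℝ → ℝ} {w : ℝ → ℝ} {a b D W : ℝ} (ha : 0 < a) (hab : a ≤ b) (hW : 0 ≤ W)
    (hK1 : ∀ e, 0 < e → ∀ u, |deriv (K e) u| ≤ (max e |u|)⁻¹ ^ 2) (hw : ∀ e ∈ Ι a b, |w e| ≤ W) :
    |∫ e in a..b, w e * deriv (K e) (D - e)| ≤ W / a := by
  have hbound : ∀ᵐ e ∂volume, e ∈ Ioc a b → ‖w e * deriv (K e) (D - e)‖ ≤ W / e ^ 2 := by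
    refine Filter.Eventually.of_forall fun e he => ?_
    have he0 : 0 < e := ha.trans he.1
    have hinv : (max e |D - e|)⁻¹ ^ 2 ≤ 1 / e ^ 2 := by
      rw [inv_pow, one_div]
      exact inv_anti₀ (by positivity) (pow_le_pow_left₀ he0.le (le_max_left _ _) 2)
    have he' : e ∈ Ι a b := by rw [uIoc_of_le hab]; exact he
    rw [Real.norm_eq_abs, abs_mul]
    calc |w e| * |deriv (K e) (D - e)| ≤ W * (1 / e ^ 2) := mul_le_mul (hw e he') ((hK1 e he0 _).trans hinv) (abs_nonneg _) hW
      _ = W / e ^ 2 := by ring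
  have hgi : IntervalIntegrable (fun e : ℝ => W / e ^ 2) volume a b := by
    refine (continuousOn_const.div (continuousOn_pow 2) fun e he => ?_).intervalIntegrable
    rw [uIcc_of_le hab] at he
    exact pow_ne_zero 2 (ha.trans_le he.1).ne'
  have h := intervalIntegral.norm_integral_le_of_norm_le hab hbound hgi
  rw [Real.norm_eq_abs] at h
  exact h.trans (intervalIntegral_const_div_sq_le ha hab hW)

/-! ## §3 The one-call bundle -/

section Bundle

variable {β Λ : ℝ} (hβ : 0 < β) (hΛ : 0 < Λ) {B₁ B₂ B₃ : ℝ} (hB₁ : ∀ x, |deriv salmhoferCutoff x| ≤ B₁) (hB₂ : ∀ x, |deriv (deriv salmhoferCutoff) x| ≤ B₂)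
  (hB₃ : ∀ x, |deriv (deriv (deriv salmhoferCutoff)) x| ≤ B₃)
  {κ κ' κ'' : ℝ → ℝ} (hκ : ∀ t, HasDerivAt κ (κ' t) t) (hκ' : ∀ t, HasDerivAt κ' (κ'' t) t) (hκ''c : Continuous κ'')
  {κ₀ κ₁ κ₂ : ℝ} (hκb : ∀ t ∈ Icc 0 1, |κ t| ≤ κ₀) (hκ'b : ∀ t ∈ Icc 0 1, |κ' t| ≤ κ₁) (hκ''b : ∀ t ∈ Icc 0 1, |κ'' t| ≤ κ₂)
  {t₁ : ℝ} (ht₀ : 0 < t₁) (ht25 : t₁ ≤ 2 / 5)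
  (hκs : ∀ t, t₁ ≤ t → κ t = 0) (hκ's : ∀ t, t₁ ≤ t → κ' t = 0) (hκ''s : ∀ t, t₁ ≤ t → κ'' t = 0)
  (hκ1 : ∀ t, t ≤ t₁ / 2 → κ t = 1) (hκ'1 : ∀ t, t ≤ t₁ / 2 → κ' t = 0) (hκ''1 : ∀ t, t ≤ t₁ / 2 → κ'' t = 0)
  {lo hi C : ℝ} (hlo : 0 < lo) (hloΛ : lo ≤ Λ) (hC : 0 < C)

set_option maxHeartbeats 400000 in
include hβ hΛ hB₁ hB₂ hB₃ hκ hκ' hκ''c hκb hκ'b hκ''b ht₀ ht25 hκs hκ's hκ''s hκ1 hκ'1 hκ''1 hlo hloΛ hC in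
/-- **THE ONE-CALL BUNDLE `ppMidKernelS_rows`** for `K e u := ppMidKernelS β Λ κ lo e u / C` with `C ≥ C₁ := (1+2κ₀)C_P1 + 2κ₁(12B₁+9)` and
`C ≥ C₂ := (1+2κ₀)C_P2 + 4κ₁C_P1 + (12B₁+9)(2κ₂+2κ₁(q′+2))` (`q′ = (2−t₁)/t₁`): the kernel rows of 5b-M `abs_intervalIntegral_levelLine_middle_le` in its shapes —
`hK` (`∀ e ∈ [lo,hi]`, `C²`), `hK0` (`|K e u| ≤ ((1+2κ₀)(12B₁+9)/C)·(max e |u|)⁻¹`, `0 < e`), `hK1`, `hK2` (normalised, every `0 < e`), `hcomp` with `q_c := 2q′ ≥ 8`,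
`hKopp` with `C_t := (8q′(Λ/lo)C₁ + ((1+2κ₀)48q′³+16κ₁q′²)/(β·lo))/C`, and `hKc` (joint continuity).  Use:
`obtain ⟨hK, hK0, hK1, hK2, hcomp, hKopp, hKc⟩ := ppMidKernelS_rows …`. [cite: BenfattoGiulianiMastropietro2006, §2.4 (2.36)] [cite: FeldmanSalmhoferTrubowitz1998, §3] -/
theorem ppMidKernelS_rows
    (hC1 : (1 + 2 * κ₀) * (128 * B₂ + 216 * B₁ + 294 + (48 * B₁ + 28) * ((2 - t₁) / t₁)) + 2 * κ₁ * (12 * B₁ + 9) ≤ C)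
    (hC2 : (1 + 2 * κ₀) * (512 * B₃ + 1664 * B₂ + 5280 * B₁ + 3424 + (256 * B₂ + 384 * B₁ + 504) * ((2 - t₁) / t₁) ^ 2 + (192 * B₁ + 112) * ((2 - t₁) / t₁)) +
          4 * κ₁ * (128 * B₂ + 216 * B₁ + 294 + (48 * B₁ + 28) * ((2 - t₁) / t₁)) +
          (12 * B₁ + 9) * (2 * κ₂ + 2 * κ₁ * ((2 - t₁) / t₁ + 2)) ≤ C) :
    (∀ e ∈ Icc lo hi, ContDiff ℝ 2 (fun v : ℝ => ppMidKernelS β Λ κ lo e v / C)) ∧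
    (∀ e : ℝ, 0 < e → ∀ u, |ppMidKernelS β Λ κ lo e u / C| ≤ (1 + 2 * κ₀) * (12 * B₁ + 9) / C * (max e |u|)⁻¹) ∧
    (∀ e : ℝ, 0 < e → ∀ u, |deriv (fun v : ℝ => ppMidKernelS β Λ κ lo e v / C) u| ≤ (max e |u|)⁻¹ ^ 2) ∧
    (∀ e : ℝ, 0 < e → ∀ u, |iteratedDeriv 2 (fun v : ℝ => ppMidKernelS β Λ κ lo e v / C) u| ≤ (max e |u|)⁻¹ ^ 3) ∧
    (∀ e ∈ Icc lo hi, ∀ u, 2 * ((2 - t₁) / t₁) * e ≤ |u| → deriv (fun v : ℝ => ppMidKernelS β Λ κ lo e v / C) u = 0) ∧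
    (∀ e ∈ Icc lo hi, ∀ u, u ≤ -(e / 4) → |deriv (fun v : ℝ => ppMidKernelS β Λ κ lo e v / C) u| ≤
      (8 * ((2 - t₁) / t₁) * (Λ / lo) * ((1 + 2 * κ₀) * (128 * B₂ + 216 * B₁ + 294 + (48 * B₁ + 28) * ((2 - t₁) / t₁)) + 2 * κ₁ * (12 * B₁ + 9)) +
          ((1 + 2 * κ₀) * (48 * ((2 - t₁) / t₁) ^ 3) + 16 * κ₁ * ((2 - t₁) / t₁) ^ 2) / (β * lo)) / C * lo * (max e |u|)⁻¹ ^ 3) ∧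
    (Continuous fun p : ℝ × ℝ => deriv (fun v : ℝ => ppMidKernelS β Λ κ lo p.1 v / C) p.2) := by
  have hκ'c : Continuous κ' := continuous_iff_continuousAt.2 fun t => (hκ' t).continuousAt
  refine ⟨fun e _ => (contDiff_two_ppMidKernelS_u hβ hΛ hB₁ hB₂ hκ hκ' hκ''c hlo e).div_const C, fun e he u => ?_, fun e he u => ?_, fun e he u => ?_,
    fun e he u hu => ?_, fun e he u hu => ?_, ?_⟩
  · rw [abs_div, abs_of_pos hC, div_mul_eq_mul_div, le_div_iff₀ hC, div_mul_cancel₀ _ hC.ne']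
    exact abs_ppMidKernelS_le_inv_max' hβ hΛ hB₁ hκb hlo he u
  · rw [deriv_div_const]
    exact abs_div_le_of_le (abs_deriv_ppMidKernelS_le hβ hΛ hB₁ hB₂ hκ hκb hκ'b ht₀ ht25 hκs hκ's hκ1 hκ'1 hlo hloΛ he u) hC1 hC (by positivity)
  · rw [iteratedDeriv_div_const]
    exact abs_div_le_of_le
      (abs_iteratedDeriv_two_ppMidKernelS_le hβ hΛ hB₁ hB₂ hB₃ hκ hκ' hκb hκ'b hκ''b ht₀ ht25 hκs hκ's hκ''s hκ1 hκ'1 hκ''1 hlo hloΛ he u) hC2 hC (by positivity)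
  · rw [deriv_div_const, (deriv_ppMidKernelS_eq_zero_of_ge hβ hΛ hB₁ hB₂ hκ hκ' ht₀ ht25 hκs hκ's hκ''s hκ1 hκ'1 hκ''1 hlo he.1 hu).1, zero_div]
  · rw [deriv_div_const, abs_div, abs_of_pos hC, div_le_iff₀ hC]
    refine (abs_deriv_ppMidKernelS_opp_le hβ hΛ hB₁ hB₂ hκ hκ' hκ''c hκb hκ'b ht₀ ht25 hκs hκ's hκ1 hκ'1 hlo hloΛ he.1 hu).trans (le_of_eq ?_)
    field_simp
  · have h := continuous_deriv_ppMidKernelS₂ hβ hΛ hB₁ hκ hlo hκ'c (κ := κ)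
    have heq : (fun p : ℝ × ℝ => deriv (fun v : ℝ => ppMidKernelS β Λ κ lo p.1 v / C) p.2) =
        fun p => deriv (fun v : ℝ => ppMidKernelS β Λ κ lo p.1 v) p.2 / C := funext fun p => by rw [deriv_div_const]
    rw [heq]
    exact h.div_const C

end Bundle


/-! ## §4 The constant-weight band flatness in the law's normalisation -/

section BandFlat

variable {β Λ : ℝ} (hβ : 0 < β) (hΛ : 0 < Λ) {B₁ B₂ : ℝ} (hB₁ : ∀ x, |deriv salmhoferCutoff x| ≤ B₁) (hB₂ : ∀ x, |deriv (deriv salmhoferCutoff) x| ≤ B₂)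
  {κ κ' : ℝ → ℝ} (hκ : ∀ t, HasDerivAt κ (κ' t) t) (hκ'c : Continuous κ')
  {κ₀ κ₁ : ℝ} (hκb : ∀ t ∈ Icc 0 1, |κ t| ≤ κ₀) (hκ'b : ∀ t ∈ Icc 0 1, |κ' t| ≤ κ₁)
  {t₁ : ℝ} (ht₀ : 0 < t₁) (ht25 : t₁ ≤ 2 / 5)
  (hκs : ∀ t, t₁ ≤ t → κ t = 0) (hκ's : ∀ t, t₁ ≤ t → κ' t = 0) (hκ1 : ∀ t, t ≤ t₁ / 2 → κ t = 1) (hκ'1 : ∀ t, t ≤ t₁ / 2 → κ' t = 0)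
  {lo C : ℝ} (hlo : 0 < lo) (hloΛ : lo ≤ Λ) (hC : 0 < C)

set_option maxHeartbeats 400000 in
include hβ hΛ hB₁ hκ hκ'c hκb hκ'b ht₀ ht25 hκs hκ's hκ1 hκ'1 hlo hloΛ hC in
/-- **CONSTANT-WEIGHT FLATNESS OF `K e := M(e,·)/C` ON A RANGE WHOSE LOWER END IS OFF THE ZONE** (`D ≥ 2q′(Λ+lo)`, `lo ≤ a ≤ b`, `2D ≤ b`,
`2q′a ≤ |D − a|` — e.g. the 5b-M band `a = max lo (D/C′)` with `C′ ≥ 2q′+1`, `b = 4D`): for a weight constant `= W` on `Ι a b`,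
`|∫_a^b w(e)·∂ᵤK(e, D−e) de| ≤ |W|·((6(1+2κ₀)/(β·lo) + 2κ₁q′)/C)·lo/D²` — the `lo/D²`-class `A_t`. [cite: BenfattoGiulianiMastropietro2006, §2.4 (2.36)] -/
theorem abs_midFlatness_band_const_weight_le {w : ℝ → ℝ} {W D a b : ℝ} (hD : 2 * ((2 - t₁) / t₁) * (Λ + lo) ≤ D) (ha : lo ≤ a) (hab : a ≤ b) (hb : 2 * D ≤ b)
    (hΦa : 2 * ((2 - t₁) / t₁) * a ≤ |D - a|) (hw : ∀ e ∈ Ι a b, w e = W) :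
    |∫ e in a..b, w e * deriv (fun v : ℝ => ppMidKernelS β Λ κ lo e v / C) (D - e)| ≤
      |W| * ((6 * (1 + 2 * κ₀) / (β * lo) + 2 * κ₁ * ((2 - t₁) / t₁)) / C) * (lo / D ^ 2) := by
  have hκ₀ : 0 ≤ κ₀ := (abs_nonneg _).trans (hκb 0 (left_mem_Icc.2 zero_le_one))
  set q : ℝ := (2 - t₁) / t₁ with hq
  have hq4 : 4 ≤ q := midRatio_ge_four ht₀ ht25
  have hD0 : 0 < D := by nlinarith
  -- constant weight and the `1/C` scaling come out of the integral
  have hcongr : ∫ e in a..b, w e * deriv (fun v : ℝ => ppMidKernelS β Λ κ lo e v / C) (D - e) =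
      W / C * ∫ e in a..b, deriv (fun v : ℝ => ppMidKernelS β Λ κ lo e v) (D - e) := by
    rw [← intervalIntegral.integral_const_mul]
    refine intervalIntegral.integral_congr_ae (Filter.Eventually.of_forall fun e he => ?_)
    rw [hw e he, deriv_div_const]; ring
  rw [hcongr, abs_mul, abs_div, abs_of_pos hC]
  have hD2 : 0 < D ^ 2 := pow_pos hD0 2
  have hT : |∫ e in a..b, deriv (fun v : ℝ => ppMidKernelS β Λ κ lo e v) (D - e)| ≤ (6 * (1 + 2 * κ₀) / β + 2 * κ₁ * q * lo) / D ^ 2 := by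
    have h := abs_midFlatness_line_le_of_ge_offZone hβ hΛ hB₁ hκ hκ'c hκb hκ'b ht₀ ht25 hκs hκ's hκ1 hκ'1 hlo hloΛ hD ha hab hb hΦa (κ := κ)
    rw [le_div_iff₀ hD2, mul_comm]; exact h
  calc |W| / C * |∫ e in a..b, deriv (fun v : ℝ => ppMidKernelS β Λ κ lo e v) (D - e)| ≤ |W| / C * ((6 * (1 + 2 * κ₀) / β + 2 * κ₁ * q * lo) / D ^ 2) :=
        mul_le_mul_of_nonneg_left hT (by positivity)
    _ = |W| * ((6 * (1 + 2 * κ₀) / (β * lo) + 2 * κ₁ * q) / C) * (lo / D ^ 2) := by field_simp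

end BandFlat

end Summit.HubbardSuperconductivity.HubbardSuperconductivity.Theorems.C4a

end
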